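import Literature.NumberTheory.QuadraticFields.ReducedQuadraticIrrationals
import Mathlib.Dynamics.PeriodicPts.Defs
import HarnessLib

/-!
# Reduced quadratic irrationals, II: finiteness, periodicity, and the products `∏ ψᵢ`

Topic `NumberTheory/QuadraticFields`; continues `ReducedQuadraticIrrationals.lean` (`QuadIrr D`,
`val`, `conj`, `step`, `IsReduced`). Theorem-and-definition file (no named facts), following
Jacobson–Williams, *Solving the Pell Equation*, §3.1–§3.3 and §5.3:

* `reducedSet D` — the finite set of reduced quotients (`mem_reducedSet_iff`, from (3.32));
* `step_injOn_isReduced` — the step is injective on reduced quotients (the inverse step `ρ⁻¹`,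
  op. cit. §5.3 pp. 111–112), hence `mem_periodicPts_of_isReduced`: **every reduced quotient is a
  periodic point of the step** (op. cit. Thm. 3.8; the cycle (5.32)), with Mathlib's
  `Function.minimalPeriod step x` as the period length `p` and `iterate_eq_iterate_iff_modEq`;
* `psi x = −1/φ̄`, `psiBar x = −1/φ` (op. cit. `ψⱼ = −1/φ̄ⱼ`, before (3.16)) with
  `psi_step`/`psiBar_step` (`ψ' = q − φ̄`, `ψ̄' = q − φ`), `psi_mul_psiBar_step`
  (`ψ'ψ̄' = −Q'/Q`), `psi_step_eq` (`ψ' = Q'φ'/Q`);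
* `psiProd x₀ n = ∏_{k=1}^{n} ψ_k`, `psiBarProd`, with the norm identity
  `psiProd_mul_psiBarProd : ∏ψ_k ∏ψ̄_k = (−1)ⁿ Qₙ/Q₀` (op. cit. (3.18)) and
  `psiProd_eq : ∏_{k=1}^{n} ψ_k = (Qₙ/Q₀) ∏_{k=1}^{n} φ_k` (op. cit. (3.17)).

These are the ingredients of `θ_{n+1} = ∏ ψ_k` (op. cit. (3.16)–(3.17)) used in the sequel to
identify the fundamental unit with the product of the complete quotients over a period
(op. cit. (5.33)–(5.34)).

## References

* M. J. Jacobson, Jr., H. C. Williams, *Solving the Pell Equation*, CMS Books in Mathematics,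
  Springer (2009), §3.1 (3.16)–(3.18), §3.3 (3.32), Thm. 3.8; §5.3 (5.32)–(5.34).
  [JacobsonWilliams2008]
-/

noncomputable section

open scoped Classical

namespace Literature.NumberTheory.QuadraticFields

namespace QuadIrr

variable {D : ℕ}

/-! ### Finiteness and periodicity -/

/-- The finite set of reduced quotients of discriminant datum `D` (a filter of the box
`[1, ⌊√D⌋] × [1, 2⌊√D⌋ + 1]`). [cite: JacobsonWilliams2008, §3.3 (3.32)] -/
def reducedSet (D : ℕ) : Finset (QuadIrr D) :=
  ((Finset.Icc (1 : ℤ) (Nat.sqrt D) ×ˢ Finset.Icc (1 : ℤ) (2 * Nat.sqrt D + 1)).image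
    fun pq => (⟨pq.1, pq.2⟩ : QuadIrr D)).filter IsReduced

/-- `reducedSet D` is exactly the set of reduced quotients. [cite: JacobsonWilliams2008, §3.3 (3.32)] -/
theorem mem_reducedSet_iff {x : QuadIrr D} : x ∈ reducedSet D ↔ x.IsReduced := by
  unfold reducedSet
  rw [Finset.mem_filter, Finset.mem_image]
  constructor
  · exact fun h => h.2
  · intro h
    obtain ⟨h1, h2, h3, h4⟩ := h.bounds
    exact ⟨⟨(x.P, x.Q), by simp [Finset.mem_Icc, h1, h2, h3, h4], rfl⟩, h⟩

/-- **The step is injective on reduced quotients** (the inverse step: `Q` is recovered as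
`(D − P'²)/Q'`, and then `P` as the unique integer `≡ −P' (mod Q)` in `(√D − Q, √D)`).
[cite: JacobsonWilliams2008, §5.3 (pp. 111–112, the operation ρ⁻¹)] -/
theorem step_injOn_isReduced (hD : ¬ IsSquare D) :
    Set.InjOn (step (D := D)) {x | x.IsReduced} := by
  intro x hx y hy hxy
  have hx' : (step x).IsReduced := isReduced_step hD hx
  have hQx := step_Q_mul_Q hx.isAdmissible
  have hQy := step_Q_mul_Q hy.isAdmissible
  rw [hxy] at hQx
  have hQ0 : (step y).Q ≠ 0 := by rw [← hxy]; exact hx'.1.ne'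
  have hQ : x.Q = y.Q := by
    have : (step y).Q * x.Q = (step y).Q * y.Q := by rw [hQx, hQy]
    exact mul_left_cancel₀ hQ0 this
  -- `P_x ≡ P_y (mod Q)` and both lie in `(√D − Q, √D)`
  have hP : (step x).P = (step y).P := by rw [hxy]
  simp only [step_P] at hP
  rw [hQ] at hP
  have hdvd : y.Q ∣ x.P - y.P := ⟨x.pq - y.pq, by linarith⟩
  have hbx1 := hx.P_lt_sqrt
  have hbx2 := hx.sqrt_lt_P_add_Q
  have hby1 := hy.P_lt_sqrt
  have hby2 := hy.sqrt_lt_P_add_Q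
  rw [hQ] at hbx2
  have hlt : |x.P - y.P| < y.Q := by
    rw [abs_lt]
    constructor
    · have : (-(y.Q : ℝ)) < x.P - y.P := by linarith
      exact_mod_cast this
    · have : (x.P : ℝ) - y.P < y.Q := by linarith
      exact_mod_cast this
  have hPeq : x.P = y.P := by
    have := Int.eq_zero_of_abs_lt_dvd hdvd hlt
    linarith
  exact QuadIrr.ext hPeq hQ

/-- Cancelling equal numbers of steps from two iterates of a reduced quotient. [cite: JacobsonWilliams2008, §5.3 (ρ⁻¹ applied repeatedly, p. 113)] -/
theorem iterate_cancel (hD : ¬ IsSquare D) {x : QuadIrr D} (h : x.IsReduced) :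
    ∀ k a b : ℕ, step^[k + a] x = step^[k + b] x → step^[a] x = step^[b] x := by
  intro k
  induction k with
  | zero => intro a b hab; simpa using hab
  | succ k ih =>
    intro a b hab
    apply ih
    rw [Nat.add_right_comm k 1 a, Nat.add_right_comm k 1 b, Function.iterate_succ_apply',
      Function.iterate_succ_apply'] at hab
    exact step_injOn_isReduced hD (isReduced_iterate hD h _) (isReduced_iterate hD h _) hab

/-- Some positive iterate of the step returns to a reduced quotient (finitely many reduced
quotients, and the step is injective on them). [cite: JacobsonWilliams2008, §3.3 Thm. 3.8 and §5.3 (5.32)] -/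
theorem exists_iterate_step_eq (hD : ¬ IsSquare D) {x : QuadIrr D} (h : x.IsReduced) :
    ∃ p : ℕ, 0 < p ∧ step^[p] x = x := by
  set N := (reducedSet D).card with hN
  have hmaps : ∀ i ∈ Finset.range (N + 1), step^[i] x ∈ reducedSet D :=
    fun i _ => mem_reducedSet_iff.mpr (isReduced_iterate hD h i)
  have hcard : (reducedSet D).card < (Finset.range (N + 1)).card := by simp [hN]
  obtain ⟨i, hi, j, hj, hne, hij⟩ := Finset.exists_ne_map_eq_of_card_lt_of_maps_to hcard hmaps
  wlog hlt : i < j generalizing i j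
  · exact this j hj i hi hne.symm hij.symm (lt_of_le_of_ne (not_lt.mp hlt) hne.symm)
  refine ⟨j - i, Nat.sub_pos_of_lt hlt, ?_⟩
  have := iterate_cancel hD h i (j - i) 0 (by rw [Nat.add_sub_cancel' hlt.le, add_zero]; exact hij.symm)
  simpa using this

/-- **Every reduced quotient is purely periodic**: it is a periodic point of the step.
[cite: JacobsonWilliams2008, §3.3 Thm. 3.8] -/
theorem mem_periodicPts_of_isReduced (hD : ¬ IsSquare D) {x : QuadIrr D} (h : x.IsReduced) :
    x ∈ Function.periodicPts (step (D := D)) := by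
  obtain ⟨p, hp, hpx⟩ := exists_iterate_step_eq hD h
  exact Function.mk_mem_periodicPts hp hpx

/-- The period length `p = minimalPeriod step x` of a reduced quotient is positive.
[cite: JacobsonWilliams2008, §3.3 (period length p)] -/
theorem minimalPeriod_pos (hD : ¬ IsSquare D) {x : QuadIrr D} (h : x.IsReduced) :
    0 < Function.minimalPeriod step x :=
  Function.minimalPeriod_pos_of_mem_periodicPts (mem_periodicPts_of_isReduced hD h)

/-- Two iterates of a reduced quotient coincide iff the indices agree modulo the period.
[cite: JacobsonWilliams2008, §5.3 (the cycle (5.32) consists of distinct ideals)] -/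
theorem iterate_eq_iterate_iff_modEq (hD : ¬ IsSquare D) {x : QuadIrr D} (h : x.IsReduced)
    (i j : ℕ) : step^[i] x = step^[j] x ↔ i ≡ j [MOD Function.minimalPeriod step x] := by
  have hp := minimalPeriod_pos hD h
  rw [← Function.iterate_mod_minimalPeriod_eq (n := i), ← Function.iterate_mod_minimalPeriod_eq (n := j),
    Function.iterate_eq_iterate_iff_of_lt_minimalPeriod (Nat.mod_lt _ hp) (Nat.mod_lt _ hp)]
  rfl

/-- A reduced quotient with prescribed `Q` is determined by the residue of `P` modulo `Q`
(as `√D − Q < P < √D`). [cite: JacobsonWilliams2008, §3.3 (3.32)] -/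
theorem eq_of_isReduced_of_Q_eq_of_dvd {x y : QuadIrr D} (hx : x.IsReduced) (hy : y.IsReduced)
    (hQ : x.Q = y.Q) (hdvd : y.Q ∣ x.P - y.P) : x = y := by
  have hbx1 := hx.P_lt_sqrt
  have hbx2 := hx.sqrt_lt_P_add_Q
  have hby1 := hy.P_lt_sqrt
  have hby2 := hy.sqrt_lt_P_add_Q
  rw [hQ] at hbx2
  have hlt : |x.P - y.P| < y.Q := by
    rw [abs_lt]
    constructor
    · have : (-(y.Q : ℝ)) < x.P - y.P := by linarith
      exact_mod_cast this
    · have : (x.P : ℝ) - y.P < y.Q := by linarith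
      exact_mod_cast this
  have hPeq : x.P = y.P := by
    have := Int.eq_zero_of_abs_lt_dvd hdvd hlt
    linarith
  exact QuadIrr.ext hPeq hQ

/-! ### The quantities `ψ = −1/φ̄`, `ψ̄ = −1/φ` and their products -/

/-- `ψ = −1/φ̄`. [cite: JacobsonWilliams2008, §3.1 (before (3.16))] -/
def psi (x : QuadIrr D) : ℝ := -1 / x.conj

/-- `ψ̄ = −1/φ`, the conjugate of `ψ`. [cite: JacobsonWilliams2008, §3.1 (before (3.16))] -/
def psiBar (x : QuadIrr D) : ℝ := -1 / x.val

/-- `ψ' = q − φ̄` for the step `x ↦ x'`. [cite: JacobsonWilliams2008, §3.1 (3.16)] -/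
theorem psi_step (hD : ¬ IsSquare D) {x : QuadIrr D} (h : x.IsAdmissible) :
    psi (step x) = x.pq - x.conj := by
  rw [psi, conj_step hD h]
  have : x.conj - x.pq ≠ 0 := by
    intro h0
    have hc : x.conj = x.pq := by linarith
    have hv : x.val = 2 * x.P / x.Q - x.pq := by linarith [val_add_conj x]
    apply (irrational_val hD h.1).ne_rat (2 * x.P / x.Q - x.pq)
    rw [hv]; push_cast; ring
  field_simp
  ring

/-- `ψ̄' = q − φ` for the step `x ↦ x'`. [cite: JacobsonWilliams2008, §3.1 (3.2)] -/
theorem psiBar_step (hD : ¬ IsSquare D) {x : QuadIrr D} (h : x.IsAdmissible) :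
    psiBar (step x) = x.pq - x.val := by
  rw [psiBar, val_step hD h]
  have : x.val - x.pq ≠ 0 := sub_ne_zero.mpr ((irrational_val hD h.1).ne_int _)
  field_simp
  ring

/-- `ψ' ψ̄' = −Q'/Q`. [cite: JacobsonWilliams2008, §3.1 (3.18)] -/
theorem psi_mul_psiBar_step (hD : ¬ IsSquare D) {x : QuadIrr D} (h : x.IsAdmissible) :
    psi (step x) * psiBar (step x) = -((step x).Q : ℝ) / x.Q := by
  rw [psi_step hD h, psiBar_step hD h]
  have hQ : (x.Q : ℝ) ≠ 0 := by exact_mod_cast h.1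
  have hmul : ((step x).Q : ℝ) * x.Q = D - ((step x).P : ℝ) ^ 2 := by exact_mod_cast step_Q_mul_Q h
  have hP : ((step x).P : ℝ) = x.pq * x.Q - x.P := by rw [step_P]; push_cast; ring
  have e1 : (x.pq - x.conj) * x.Q = (step x).P + Real.sqrt D := by
    unfold conj; rw [hP]; field_simp; ring
  have e2 : (x.pq - x.val) * x.Q = (step x).P - Real.sqrt D := by
    unfold val; rw [hP]; field_simp; ring
  have hs := sqrt_sq (D := D)
  have key : (x.pq - x.conj) * (x.pq - x.val) * x.Q * x.Q = -((step x).Q : ℝ) * x.Q := by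
    calc (x.pq - x.conj) * (x.pq - x.val) * x.Q * x.Q
        = ((x.pq - x.conj) * x.Q) * ((x.pq - x.val) * x.Q) := by ring
      _ = ((step x).P + Real.sqrt D) * ((step x).P - Real.sqrt D) := by rw [e1, e2]
      _ = ((step x).P : ℝ) ^ 2 - D := by linear_combination -hs
      _ = -((step x).Q : ℝ) * x.Q := by linear_combination hmul
  rw [eq_div_iff hQ]
  exact mul_right_cancel₀ hQ (by linear_combination key)

/-- `ψ̄ ≠ 0` for a reduced quotient. [cite: JacobsonWilliams2008, §3.3 (3.36)] -/
theorem IsReduced.psiBar_ne_zero {x : QuadIrr D} (h : x.IsReduced) : psiBar x ≠ 0 := by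
  unfold psiBar
  have := h.2.2.1
  exact div_ne_zero (by norm_num) (by linarith)

/-- `ψ > 1` for a reduced quotient (`−1 < φ̄ < 0`). [cite: JacobsonWilliams2008, §3.3 (3.34)] -/
theorem IsReduced.one_lt_psi {x : QuadIrr D} (h : x.IsReduced) : 1 < psi x := by
  unfold psi
  have h1 := h.2.2.2.1
  have h2 := h.2.2.2.2
  rw [lt_div_iff_of_neg h2]
  linarith

/-- `ψ' = Q' φ'/Q` for the step `x ↦ x'` of admissible data stepping to a reduced quotient.
[cite: JacobsonWilliams2008, §3.1 (ψ_k = Q_k φ_k / Q_{k-1}, before (3.17))] -/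
theorem psi_step_eq (hD : ¬ IsSquare D) {x : QuadIrr D} (h : x.IsAdmissible)
    (h' : (step x).IsReduced) : psi (step x) = (step x).Q * (step x).val / x.Q := by
  have hprod := psi_mul_psiBar_step hD h
  have hne := h'.psiBar_ne_zero
  have hval : (step x).val ≠ 0 := by linarith [h'.2.2.1]
  have : psi (step x) = -((step x).Q : ℝ) / x.Q / psiBar (step x) := by
    rw [← hprod, mul_div_cancel_right₀ _ hne]
  rw [this, psiBar]
  have hQ : (x.Q : ℝ) ≠ 0 := by exact_mod_cast h.1
  field_simp

/-- `∏_{k=1}^{n} ψ_k` along the expansion of `x₀`. [cite: JacobsonWilliams2008, §3.1 (3.17)] -/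
def psiProd (x₀ : QuadIrr D) (n : ℕ) : ℝ := ∏ k ∈ Finset.range n, psi (step^[k + 1] x₀)

/-- `∏_{k=1}^{n} ψ̄_k` along the expansion of `x₀`. [cite: JacobsonWilliams2008, §3.1 (3.18)] -/
def psiBarProd (x₀ : QuadIrr D) (n : ℕ) : ℝ := ∏ k ∈ Finset.range n, psiBar (step^[k + 1] x₀)

/-- `∏_{k=1}^{n} φ_k` along the expansion of `x₀`. [cite: JacobsonWilliams2008, §3.1 (3.17)] -/
def valProd (x₀ : QuadIrr D) (n : ℕ) : ℝ := ∏ k ∈ Finset.range n, (step^[k + 1] x₀).val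

/-- Iterates of admissible data are admissible. [cite: JacobsonWilliams2008, §3.1 (3.11)] -/
theorem isAdmissible_iterate (hD : ¬ IsSquare D) {x : QuadIrr D} (h : x.IsAdmissible) (n : ℕ) :
    (step^[n] x).IsAdmissible := by
  induction n with
  | zero => exact h
  | succ n ih => rw [Function.iterate_succ_apply']; exact isAdmissible_step hD ih

/-- **The norm identity `(∏ ψ_k)(∏ ψ̄_k) = (−1)ⁿ Qₙ/Q₀`.** [cite: JacobsonWilliams2008, §3.1 (3.18)] -/
theorem psiProd_mul_psiBarProd (hD : ¬ IsSquare D) {x₀ : QuadIrr D} (h : x₀.IsAdmissible) (n : ℕ) :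
    psiProd x₀ n * psiBarProd x₀ n = (-1) ^ n * (step^[n] x₀).Q / x₀.Q := by
  induction n with
  | zero =>
    have hQ : (x₀.Q : ℝ) ≠ 0 := by exact_mod_cast h.1
    simp [psiProd, psiBarProd, hQ]
  | succ n ih =>
    rw [psiProd, psiBarProd, Finset.prod_range_succ, Finset.prod_range_succ, ← psiProd, ← psiBarProd,
      mul_mul_mul_comm, ih, Function.iterate_succ_apply', psi_mul_psiBar_step hD (isAdmissible_iterate hD h n)]
    have hQn : ((step^[n] x₀).Q : ℝ) ≠ 0 := by exact_mod_cast (isAdmissible_iterate hD h n).1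
    have hQ : (x₀.Q : ℝ) ≠ 0 := by exact_mod_cast h.1
    field_simp
    ring

/-- **`∏_{k=1}^{n} ψ_k = (Qₙ/Q₀) ∏_{k=1}^{n} φ_k`** when all of `x₁, …, xₙ` are reduced (e.g. `x₀`
pre-reduced). [cite: JacobsonWilliams2008, §3.1 (3.17)] -/
theorem psiProd_eq (hD : ¬ IsSquare D) {x₀ : QuadIrr D} (h : x₀.IsAdmissible)
    (hred : ∀ k, (step^[k + 1] x₀).IsReduced) (n : ℕ) :
    psiProd x₀ n = (step^[n] x₀).Q / x₀.Q * valProd x₀ n := by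
  induction n with
  | zero =>
    have hQ : (x₀.Q : ℝ) ≠ 0 := by exact_mod_cast h.1
    simp [psiProd, valProd, hQ]
  | succ n ih =>
    rw [psiProd, valProd, Finset.prod_range_succ, Finset.prod_range_succ, ← psiProd, ← valProd, ih]
    have hk := hred n
    rw [Function.iterate_succ_apply'] at hk ⊢
    rw [psi_step_eq hD (isAdmissible_iterate hD h n) hk]
    have hQn : ((step^[n] x₀).Q : ℝ) ≠ 0 := by exact_mod_cast (isAdmissible_iterate hD h n).1
    have hQ : (x₀.Q : ℝ) ≠ 0 := by exact_mod_cast h.1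
    field_simp

/-- All of `x₁, x₂, …` are reduced when `x₀` is pre-reduced. [cite: JacobsonWilliams2008, §3.3 Prop. 3.4] -/
theorem IsPreReduced.isReduced_iterate_succ (hD : ¬ IsSquare D) {x₀ : QuadIrr D}
    (h : x₀.IsPreReduced) (k : ℕ) : (step^[k + 1] x₀).IsReduced := by
  rw [Function.iterate_succ_apply]
  exact isReduced_iterate hD (h.isReduced_step hD) k

/-- `∏_{k=1}^{n} ψ_k ≥ 1` (each factor exceeds `1`) when `x₀` is pre-reduced.
[cite: JacobsonWilliams2008, §3.3 (3.34)] -/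
theorem IsPreReduced.one_le_psiProd (hD : ¬ IsSquare D) {x₀ : QuadIrr D} (h : x₀.IsPreReduced)
    (n : ℕ) : 1 ≤ psiProd x₀ n := by
  unfold psiProd
  exact Finset.one_le_prod fun k _ => ((h.isReduced_iterate_succ hD k).one_lt_psi).le

/-- `∏_{k=1}^{n+1} ψ_k > 1` when `x₀` is pre-reduced. [cite: JacobsonWilliams2008, §3.3 (3.34)] -/
theorem IsPreReduced.one_lt_psiProd_succ (hD : ¬ IsSquare D) {x₀ : QuadIrr D} (h : x₀.IsPreReduced)
    (n : ℕ) : 1 < psiProd x₀ (n + 1) := by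
  have h1 := h.one_le_psiProd hD n
  have h2 := (h.isReduced_iterate_succ hD n).one_lt_psi
  rw [psiProd, Finset.prod_range_succ, ← psiProd]
  nlinarith

end QuadIrr

end Literature.NumberTheory.QuadraticFields

end
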